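import Summits.Langlands.Langlands.Theorems.HalfIntegralTwistCM.Negative.ModulusParallel
import Literature.NumberTheory.Automorphic.HarishChandraGLParameterOfCharacter
import Literature.NumberTheory.GaloisRepresentations.HeckeCharacterArchExistence
import HarnessLib

/-!
# Weil's unit relation in congruence form for a `GL₁` datum over a totally complex field

Helper file for the crux `HalfIntegralTwistCM` (stmt-Langlands-14036) of the route
`IrreducibilityBySelfDuality`, line `two-primary-chevalley-core`, stub S3
(`stub_unitRelationCongruence`): for a totally complex number field `K` and an automorphic `GL₁` datum
`ω` with archimedean parameter `ι ↦ {E ι}`, the integers `e_w = E σ_w - E σ̄_w` and a rational modulus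
`a > 0` exist such that the unit product of unitary type `(e_w, Im (E σ_w + E σ̄_w))`,
`unitArchProduct K e T u = ∏_w (σ_w u/|σ_w u|)^{e_w} |σ_w u|^{i T_w}`, is `1` for every global unit
`u ≡ 1 (mod a)`.  This is the NECESSITY half of Weil's unit criterion (Weil 1956; Patrikis 2019,
Lemma 2.1.1 (⇒)) in CONGRUENCE form, for quasi-characters with complex exponents.

Proof, on proved ground of the tree.  Let `θ = χ_ω` be the Hecke character of `ω`
(`AutomorphicRepData.exists_heckeCharacter_glOne`).  It has a module of definition `(T, e)`
(`HeckeCharacter.exists_isModulus`); with `a := N(𝔪(T, e))` every unit `u ≡ 1 (mod a)` is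
`≡ 1 mod 𝔪(T, e)`, so `θ((u)_∞) = 1` (Neukirch's decomposition of the principal idele `(u)`,
`HeckeCharacter.map_principalIdele_eq` + `map_prod_localUnits_eq_one_of_isModulus`; the argument of
`HeckeCharacter.map_infiniteIdeles_unit_eq_one_of_isModulus` of `HeckeCharacterArchTypeProofs`).  On the other hand the exponential formula for
`θ_∞` (`heckeCharacter_infiniteIdeles_eq_exp_sum`, copied from the standing disprover's workfile
`Cruxes/HalfIntegralTwistCM/Disproof.lean` §10, sorry-free there and here) reads
`θ((u)_∞) = exp (∑_w (a_w E σ_w + ā_w E σ̄_w))` for `e^{a_w} = σ_w u`, and each factor is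
`|σ_w u|^{Re (E σ_w + E σ̄_w)} · archUnitaryValue e_w (Im (E σ_w + E σ̄_w)) (σ_w u)` (the bridge identity
`exp_linear_eq_norm_cpow_mul_archUnitaryValue`, Disproof §10b); the real parts are parallel
(`exists_re_archParam_parallel_glOne`, `= 2σ`) and `∏_w |σ_w u|² = |N u| = 1`, whence the claim.
The finite-exponent model is `unit_relation_weilForm_glOne` of Disproof §10b (credit: the standing
disprover of stmt-Langlands-14036, cdisprove cycle 2).  No new definitions; Mathlib + the tree only.
-/

noncomputable section

set_option linter.dupNamespace false -- project-wide option (lakefile weak.linter.dupNamespace); `Summit.Langlands.Langlands` is the mandated namespace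

open scoped MatrixGroups Matrix Classical NumberField ComplexConjugate
open NumberField NumberField.InfinitePlace NumberField.mixedEmbedding IsDedekindDomain

namespace Summit.Langlands.Langlands.Theorems.HalfIntegralTwistCM

open Literature.NumberTheory.Automorphic
open Literature.NumberTheory.GaloisRepresentations
open Summit.Langlands.Langlands.Theorems.HalfIntegralTwistCM.Negative

variable {K : Type} [Field K] [NumberField K] {hcpt : isCompact_glFiniteIntegralLevel 1 K}

/-! ## The exponential formula for `θ_∞` (Disproof §10, copied) -/

/-- **The Hecke character of a `GL₁` datum on exponential infinite ideles** (all places at once): if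
`θ` is the Hecke character of `π = W / W'` (`r(g) φ - θ(det g) φ ∈ W'`), `P` its archimedean parameter
with `P σ_w = {c_w}` at real `w` and `P σ_w = {p_w}`, `P σ̄_w = {q_w}` at complex `w`, and the infinite
idele `x` has coordinates `ι_w(x_w) = e^{r_w}` (`r_w ∈ ℝ`, real `w`) and `ι_w(x_w) = e^{a_w}` (complex
`w`), then `θ((x, 1)) = exp (∑_{w real} r_w c_w + ∑_{w complex} (a_w p_w + ā_w q_w))` — i.e.
`θ_∞ = ∏_{w real} |·|^{c_w} ∏_{w complex} z^{p_w} z̄^{q_w}` on the image of `exp`. (The idele `(x,1)` is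
`det (exp Y, 1)` for the matrix `Y = (r, a)`, along which `θ` is `e^{d(Y)}`; `d` is read off `P` by the
Harish-Chandra clauses.)  Copied from the disprover's workfile
`Cruxes/HalfIntegralTwistCM/Disproof.lean`, §10 (the inclusion `𝔤𝔩₁(K_∞) → ⊤` written as a bare linear map).  Gelbart 1975, §2.A; Clozel 1990, §3.3; Knapp 2002,
Thm. 5.44. [cite: Clozel1990, §3.3] -/
theorem heckeCharacter_infiniteIdeles_eq_exp_sum
    (π : AutomorphicRepData (AutomorphyDatum.gl 1 K hcpt)) {θ : HeckeCharacter K}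
    (hθ : ∀ (g : (AdelicGroupData.gl 1 K).Adelic), ∀ φ ∈ π.W,
      rightTranslation (AdelicGroupData.gl 1 K) g φ -
        ((θ (Matrix.GeneralLinearGroup.det g) : ℂˣ) : ℂ) • φ ∈ π.W')
    {P : (K →+* ℂ) → Multiset ℂ} (hP : π.HasArchParameter P)
    {c : {w : InfinitePlace K // w.IsReal} → ℂ} (hc : ∀ w, P w.1.embedding = {c w})
    {p q : {w : InfinitePlace K // w.IsComplex} → ℂ} (hp : ∀ w, P w.1.embedding = {p w})
    (hq : ∀ w, P (ComplexEmbedding.conjugate w.1.embedding) = {q w})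
    (x : (InfiniteAdeleRing K)ˣ) (r : {w : InfinitePlace K // w.IsReal} → ℝ)
    (a : {w : InfinitePlace K // w.IsComplex} → ℂ)
    (hr : ∀ w, Completion.extensionEmbedding w.1 ((x : InfiniteAdeleRing K) w.1) =
      ((Real.exp (r w) : ℝ) : ℂ))
    (ha : ∀ w, Completion.extensionEmbedding w.1 ((x : InfiniteAdeleRing K) w.1) = Complex.exp (a w)) :
    ((θ (infiniteIdeles K x) : ℂˣ) : ℂ) =
      Complex.exp (∑ w, (r w : ℂ) * c w + ∑ w, (a w * p w + conj (a w) * q w)) := by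
  classical
  -- the Lie algebra acts on the line `W / W'` through the real linear form `d'`
  obtain ⟨ρ, hρ⟩ := π.exists_hasLieAction_gl
  obtain ⟨d', hd'⟩ := π.exists_linearMap_lieAction_eq_smul_one_glOne ρ
  -- the link `θ(det (exp Y, 1)) = e^{d'(Y)}`
  have hlink : ∀ Y : Matrix (Fin 1) (Fin 1) (mixedSpace K),
      ((θ (Matrix.GeneralLinearGroup.det (GLn.ofInfinite 1 K (expGL Y))) : ℂˣ) : ℂ) =
        Complex.exp (d' ⟨Y, trivial⟩) := by
    intro Y
    have h := π.heckeCharacter_glOne_det_ofArch_expMem hθ ⟨Y, trivial⟩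
      (fun φ hφ => π.lieDeriv_sub_smul_mem_of_hasLieAction_glOne hρ hd' ⟨Y, trivial⟩ hφ) 1
    rw [one_smul, Complex.ofReal_one, one_mul] at h
    exact h
  obtain ⟨hre, hco⟩ := π.archParameter_clauses_glOne hρ d' hd' hP
  -- `d'` as a linear form on all of `𝔤𝔩₁(K_∞)` (the inclusion `Y ↦ ⟨Y, trivial⟩` into `⊤` is linear)
  let incl : Matrix (Fin 1) (Fin 1) (mixedSpace K) →ₗ[ℝ] (AutomorphyDatum.gl 1 K hcpt).arch.lie :=
    { toFun := fun Y => ⟨Y, trivial⟩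
      map_add' := fun _ _ => rfl
      map_smul' := fun _ _ => rfl }
  let D : Matrix (Fin 1) (Fin 1) (mixedSpace K) →ₗ[ℝ] ℂ := d' ∘ₗ incl
  have hD : ∀ Y, D Y = d' ⟨Y, trivial⟩ := fun Y => rfl
  -- real places: `D(r · 1_w) = r c_w`
  have hDre : ∀ (w : {w : InfinitePlace K // w.IsReal}) (s : ℝ),
      D (realPlaceLie 1 w (s • (1 : Matrix (Fin 1) (Fin 1) ℝ))) = (s : ℂ) * c w := by
    intro w s
    have h1 : realPlaceLie 1 w (s • (1 : Matrix (Fin 1) (Fin 1) ℝ)) = s • realPlaceLie 1 w 1 := by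
      rw [map_smul]
    rw [h1, map_smul, hD, Complex.real_smul]
    congr 1
    exact Multiset.singleton_inj.1 ((hre w).symm.trans (hc w))
  -- complex places: `D(b_w) = b p_w + b̄ q_w`
  have hDco : ∀ (w : {w : InfinitePlace K // w.IsComplex}) (b : ℂ),
      D (complexPlaceLie 1 w (b • (1 : Matrix (Fin 1) (Fin 1) ℂ))) = b * p w + conj b * q w := by
    intro w b
    -- the real linear form `L(b) = d'(b_w)` (as in `Negative.archParam_complexPlace_glOne`)
    let L : ℂ →ₗ[ℝ] ℂ :=
      { toFun := fun b => d' ⟨complexPlaceLie 1 w (b • (1 : Matrix (Fin 1) (Fin 1) ℂ)), trivial⟩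
        map_add' := fun b c => by
          have : complexPlaceLie 1 w ((b + c) • (1 : Matrix (Fin 1) (Fin 1) ℂ)) =
              complexPlaceLie 1 w (b • (1 : Matrix (Fin 1) (Fin 1) ℂ)) +
                complexPlaceLie 1 w (c • (1 : Matrix (Fin 1) (Fin 1) ℂ)) := by
            rw [add_smul, map_add]
          rw [← map_add]
          exact congrArg d' (Subtype.ext this)
        map_smul' := fun r b => by
          have : complexPlaceLie 1 w ((r • b) • (1 : Matrix (Fin 1) (Fin 1) ℂ)) =
              r • complexPlaceLie 1 w (b • (1 : Matrix (Fin 1) (Fin 1) ℂ)) := by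
            rw [smul_assoc, map_smul]
          rw [RingHom.id_apply, ← map_smul]
          exact congrArg d' (Subtype.ext this) }
    have hL : ∀ b : ℂ, L b = d' ⟨complexPlaceLie 1 w (b • (1 : Matrix (Fin 1) (Fin 1) ℂ)), trivial⟩ :=
      fun b => rfl
    have hsum : L b = b * HCEmb.proj (L : ℂ → ℂ) (AlgHom.id ℝ ℂ) 1 +
        conj b * HCEmb.proj (L : ℂ → ℂ) (Complex.conjAe : ℂ →ₐ[ℝ] ℂ) 1 := by
      have h := HCEmb.sum_proj (𝕜 := ℂ) L.toAddMonoidHom b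
      rw [LinearMap.toAddMonoidHom_coe] at h
      rw [← h]
      obtain ⟨huniv, hne⟩ := univ_algHom_complex_eq
      rw [huniv, Finset.sum_pair hne]
      have h1 := HCEmb.proj_smul L (AlgHom.id ℝ ℂ) b (1 : ℂ)
      have h2 := HCEmb.proj_smul L (Complex.conjAe : ℂ →ₐ[ℝ] ℂ) b (1 : ℂ)
      rw [smul_eq_mul, mul_one, smul_eq_mul] at h1 h2
      rw [h1, h2]
      rfl
    have hpw : HCEmb.proj (L : ℂ → ℂ) (AlgHom.id ℝ ℂ) 1 = p w := by
      have h := hco w (AlgHom.id ℝ ℂ)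
      rw [algHomId_toRingHom_comp] at h
      exact Multiset.singleton_inj.1 (h.symm.trans (hp w))
    have hqw : HCEmb.proj (L : ℂ → ℂ) (Complex.conjAe : ℂ →ₐ[ℝ] ℂ) 1 = q w := by
      have h := hco w (Complex.conjAe : ℂ →ₐ[ℝ] ℂ)
      rw [conjAe_toRingHom_comp] at h
      exact Multiset.singleton_inj.1 (h.symm.trans (hq w))
    have hDL : D (complexPlaceLie 1 w (b • (1 : Matrix (Fin 1) (Fin 1) ℂ))) = L b := rfl
    rw [hDL, hsum, hpw, hqw]
  -- the matrix `Y = (r, a)` and the decomposition of `D Y`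
  set Y : Matrix (Fin 1) (Fin 1) (mixedSpace K) :=
    Matrix.of fun _ _ => ((fun w => r w, fun w => a w) : mixedSpace K) with hY
  have hY00 : Y 0 0 = ((fun w => r w, fun w => a w) : mixedSpace K) := rfl
  have hYre : ∀ w : {w : InfinitePlace K // w.IsReal},
      Y.map (fun y : mixedSpace K => y.1 w) = r w • (1 : Matrix (Fin 1) (Fin 1) ℝ) := by
    intro w
    ext i j
    fin_cases i; fin_cases j
    simp [hY]
  have hYco : ∀ w : {w : InfinitePlace K // w.IsComplex},
      Y.map (fun y : mixedSpace K => y.2 w) = a w • (1 : Matrix (Fin 1) (Fin 1) ℂ) := by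
    intro w
    ext i j
    fin_cases i; fin_cases j
    simp [hY]
  have hDY : D Y = ∑ w, (r w : ℂ) * c w + ∑ w, (a w * p w + conj (a w) * q w) := by
    conv_lhs => rw [eq_sum_realPlaceLie_add_sum_complexPlaceLie 1 Y]
    rw [map_add, map_sum, map_sum]
    congr 1
    · exact Finset.sum_congr rfl fun w _ => by rw [hYre, hDre]
    · exact Finset.sum_congr rfl fun w _ => by rw [hYco, hDco]
  -- `(x, 1) = det (exp Y, 1)`
  have hx : infiniteIdeles K x = Matrix.GeneralLinearGroup.det (GLn.ofInfinite 1 K (expGL Y)) := by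
    refine idele_eq_of_snd_eq_of_extensionEmbedding_eq K ?_ (fun w => ?_)
    · rw [det_ofInfinite_snd]
      rfl
    · rw [extensionEmbedding_det_ofInfinite_expGL, infiniteIdeles_fst, hY00]
      by_cases hw : w.IsReal
      · rw [dif_pos hw]
        exact hr ⟨w, hw⟩
      · rw [dif_neg hw]
        exact ha ⟨w, not_isReal_iff_isComplex.1 hw⟩
  rw [hx, hlink, ← hD, hDY]

/-! ## The bridge to the `archUnitaryValue` form (Disproof §10b, copied) -/

/-- `(e^x)^s = e^{x s}` for real `x` (principal power of a positive real).  Copied from the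
disprover's workfile `Cruxes/HalfIntegralTwistCM/Disproof.lean`, §10b. [folklore] -/
theorem ofReal_exp_cpow_eq_exp_mul (x : ℝ) (s : ℂ) :
    ((Real.exp x : ℝ) : ℂ) ^ s = Complex.exp (x * s) := by
  have hpos : (0 : ℝ) < Real.exp x := Real.exp_pos x
  have hne : ((Real.exp x : ℝ) : ℂ) ≠ 0 := by exact_mod_cast hpos.ne'
  rw [Complex.cpow_def_of_ne_zero hne, Complex.ofReal_exp,
    Complex.log_exp (by simp [Real.pi_pos]) (by simpa using Real.pi_pos.le)]

/-- **Bridge to Weil's form**: for `p - q = m ∈ ℤ` the value `e^{a p + ā q}` of `z^p z̄^q` at `z = e^a`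
is `|z|^{Re(p+q)} · (z/|z|)^m |z|^{i Im(p+q)}`.  Copied from the disprover's workfile
`Cruxes/HalfIntegralTwistCM/Disproof.lean`, §10b (the ideator's bridge identity of card
torsion-blind-unit-criterion). [folklore] -/
theorem exp_linear_eq_norm_cpow_mul_archUnitaryValue (p q : ℂ) (m : ℤ) (hm : p - q = m) (a : ℂ) :
    Complex.exp (a * p + conj a * q) =
      ((‖Complex.exp a‖ : ℂ) ^ (((p + q).re : ℝ) : ℂ)) *
        archUnitaryValue m ((p + q).im) (Complex.exp a) := by
  obtain ⟨x, y, rfl⟩ : ∃ x y : ℝ, a = x + y * Complex.I := ⟨a.re, a.im, (Complex.re_add_im a).symm⟩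
  have hre : ((x : ℂ) + y * Complex.I).re = x := by simp
  have hnorm : ‖Complex.exp (x + y * Complex.I)‖ = Real.exp x := by rw [Complex.norm_exp, hre]
  have hratio : Complex.exp (x + y * Complex.I) / (‖Complex.exp (x + y * Complex.I)‖ : ℂ) =
      Complex.exp (y * Complex.I) := by
    rw [hnorm, Complex.ofReal_exp, ← Complex.exp_sub]
    congr 1; ring
  have hq : q = p - m := by rw [← hm]; ring
  unfold archUnitaryValue
  rw [hratio, hnorm, ofReal_exp_cpow_eq_exp_mul, ofReal_exp_cpow_eq_exp_mul, ← Complex.exp_int_mul,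
    ← Complex.exp_add, ← Complex.exp_add]
  congr 1
  simp only [map_add, map_mul, Complex.conj_ofReal, Complex.conj_I]
  rw [hq]
  have h2 := Complex.re_add_im (p + (p - m))
  linear_combination (-(x : ℂ)) * h2

/-! ## The congruence modulus of a Hecke character on the units -/

/-- **A Hecke character kills the infinite parts of the units of a congruence subgroup.** For every
Hecke (quasi-)character `χ` of `K` there is a rational modulus `a ≥ 1` with `χ((u)_∞, 1) = 1` for all
units `u ≡ 1 (mod a)` of `𝓞 K`: take a module of definition `(T, e)` of `χ` (`exists_isModulus`) and
`a := N(𝔪(T, e)) ∈ 𝔪(T, e)` (`Ideal.absNorm_mem`); a unit `u ≡ 1 (mod a)` is `≡ 1 mod 𝔪(T, e)`, and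
the principal idele of `u` splits as `(u)_∞ · ∏_{v ∈ T} ⟨u⟩_v ·` (an idele of `I_f^𝔪`)
(`HeckeCharacter.map_principalIdele_eq`), the factors at `T` being killed because `u ≡ 1 mod 𝔭_v^{e_v+1}`
(`map_prod_localUnits_eq_one_of_isModulus`).  This is the idelic heart of the necessity half of Weil's
unit criterion, in congruence form (the argument of
`HeckeCharacter.map_infiniteIdeles_unit_eq_one_of_isModulus`, `HeckeCharacterArchTypeProofs`, and of the
disprover's `heckeCharacter_exists_pow_map_infiniteIdeles_units_eq_one`, Disproof §10).  Weil 1956, §1;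
Neukirch, *Algebraic Number Theory*, Ch. VII §6, proof of (6.13); Patrikis 2019, Lemma 2.1.1 (⇒).
[cite: Patrikis2019, Lemma 2.1.1] -/
theorem heckeCharacter_exists_modulus_map_infiniteIdeles_unit_eq_one (χ : HeckeCharacter K) :
    ∃ a : ℕ, 0 < a ∧ ∀ u : (𝓞 K)ˣ, (a : 𝓞 K) ∣ (u : 𝓞 K) - 1 →
      χ (infiniteIdeles K (globalToInfiniteUnits K
        (Units.map (algebraMap (𝓞 K) K : 𝓞 K →* K) u))) = 1 := by
  classical
  obtain ⟨T, e, hmod⟩ := χ.exists_isModulus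
  refine ⟨Ideal.absNorm (HeckeCharacter.modulusIdeal T e),
    Nat.pos_of_ne_zero (mt Ideal.absNorm_eq_zero_iff.1 (HeckeCharacter.modulusIdeal_ne_bot T e)),
    fun u hu => ?_⟩
  -- `u ≡ 1 mod 𝔪(T, e)`
  have hum : (u : 𝓞 K) - 1 ∈ HeckeCharacter.modulusIdeal T e := by
    obtain ⟨b, hb⟩ := hu
    rw [hb]
    exact Ideal.mul_mem_right _ _ (Ideal.absNorm_mem _)
  set k : Kˣ := Units.map (algebraMap (𝓞 K) K : 𝓞 K →* K) u with hk
  have hkval : (k : K) = algebraMap (𝓞 K) K (u : 𝓞 K) := rfl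
  -- `k` is a unit at every finite place
  have hunit : ∀ v : HeightOneSpectrum (𝓞 K), v.valuation K (k : K) = 1 := by
    intro v
    rw [hkval]
    refine (HeightOneSpectrum.valuation_eq_one_iff_notMem (K := K) v).mpr fun hmem => ?_
    exact v.isPrime.ne_top (Ideal.eq_top_of_isUnit_mem _ hmem (Units.isUnit _))
  have hB := HeckeCharacter.map_principalIdele_eq hmod k (S := T) subset_rfl (fun v _ => hunit v)
  -- the local factors at `T` are killed: `k ≡ 1 mod 𝔪`
  have hT : ∏ v ∈ T, χ (localUnits v (globalToLocalUnits v k)) = 1 := by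
    rw [← map_prod]
    refine HeckeCharacter.map_prod_localUnits_eq_one_of_isModulus hmod
      (fun v => globalToLocalUnits v k) (fun v _ => ?_) (fun v hv => ?_)
    · rw [val_globalToLocalUnits,
        Literature.NumberTheory.GaloisRepresentations.valued_algebraMap_adicCompletion]
      exact hunit v
    · rw [val_globalToLocalUnits]
      have hsub : algebraMap K (v.adicCompletion K) (k : K) - 1 =
          algebraMap K (v.adicCompletion K) (algebraMap (𝓞 K) K ((u : 𝓞 K) - 1)) := by
        rw [map_sub, map_one, map_sub, map_one, hkval]
      rw [hsub, Literature.NumberTheory.GaloisRepresentations.valued_algebraMap_adicCompletion,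
        HeightOneSpectrum.valuation_of_algebraMap]
      have hmem : (u : 𝓞 K) - 1 ∈ v.asIdeal ^ (e v + 1) :=
        Ideal.le_of_dvd (HeckeCharacter.pow_dvd_modulusIdeal e hv) hum
      calc v.intValuation ((u : 𝓞 K) - 1)
          ≤ WithZero.exp (-((e v + 1 : ℕ) : ℤ)) :=
            (HeightOneSpectrum.intValuation_le_pow_iff_mem v _ (e v + 1)).mpr hmem
        _ ≤ WithZero.exp (-(e v : ℤ)) := WithZero.exp_le_exp.mpr (by push_cast; linarith)
  rwa [hT, mul_one] at hB

/-! ## The stub: Weil's necessity in congruence form -/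

/-- **Weil's NECESSITY in congruence form** (stub S3 = `UnitRelationCongruence` of the line
`two-primary-chevalley-core` of the crux `HalfIntegralTwistCM`; any totally complex number field, any
`GL₁` datum): if `ω` has archimedean parameter `ι ↦ {E ι}` then `e_w := E σ_w - E σ̄_w` is an integer
(`archParam_embedding_sub_conj_mem_int_glOne`) and the unit product of unitary type `(e_w, T_w)`,
`T_w = Im (E σ_w + E σ̄_w)`, is `1` on the units `≡ 1 (mod a)` for some `a > 0`.  Proof: `θ = χ_ω`
(`exists_heckeCharacter_glOne`) kills `(u)_∞` for `u ≡ 1 (mod a)`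
(`heckeCharacter_exists_modulus_map_infiniteIdeles_unit_eq_one`); the exponential formula
(`heckeCharacter_infiniteIdeles_eq_exp_sum`) with `a_w = log σ_w(u)`, the bridge
`exp_linear_eq_norm_cpow_mul_archUnitaryValue`, parallel real weights
(`exists_re_archParam_parallel_glOne`) and the product formula `∏_w |σ_w u|² = |N u| = 1`
(`prod_eq_abs_norm`) turn `θ((u)_∞) = 1` into `unitArchProduct K e T u = 1`.  The finite-exponent
model is the disprover's `unit_relation_weilForm_glOne` (Disproof §10b).  Weil 1956, §1; Patrikis
2019, Lemma 2.1.1 (⇒), here for quasi-characters with complex exponents.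
[cite: Patrikis2019, Lemma 2.1.1] -/
theorem stub_unitRelationCongruence :
    ∀ (K : Type) [Field K] [NumberField K] [IsTotallyComplex K]
      (h1 : isCompact_glFiniteIntegralLevel 1 K) (ω : CuspidalAutomorphicRepData 1 K h1)
      (E : (K →+* ℂ) → ℂ), ω.1.HasArchParameter (fun ι => {E ι}) →
        ∃ (e : InfinitePlace K → ℤ) (a : ℕ), 0 < a ∧
          (∀ w : InfinitePlace K,
            (e w : ℂ) = E w.embedding - E (ComplexEmbedding.conjugate w.embedding)) ∧
          ∀ u : (𝓞 K)ˣ, (a : 𝓞 K) ∣ (u : 𝓞 K) - 1 →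
            unitArchProduct K e
              (fun w => (E w.embedding + E (ComplexEmbedding.conjugate w.embedding)).im) u = 1 := by
  intro K _ _ _ h1 ω E hω
  haveI : IsEmpty {w : InfinitePlace K // w.IsReal} :=
    ⟨fun w => (not_isReal_iff_isComplex.mpr (IsTotallyComplex.isComplex w.1)) w.2⟩
  have hc : ∀ w : InfinitePlace K, w.IsComplex := fun w => IsTotallyComplex.isComplex w
  -- the integers `e_w = E σ_w - E σ̄_w`
  have hex : ∀ w : InfinitePlace K, ∃ m : ℤ,
      (m : ℂ) = E w.embedding - E (ComplexEmbedding.conjugate w.embedding) := by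
    intro w
    obtain ⟨p, q, m, hp, hq, hm⟩ := archParam_embedding_sub_conj_mem_int_glOne ω.1 hω ⟨w, hc w⟩
    refine ⟨m, ?_⟩
    have hp' : E w.embedding = p := Multiset.singleton_inj.1 hp
    have hq' : E (ComplexEmbedding.conjugate w.embedding) = q := Multiset.singleton_inj.1 hq
    rw [hp', hq', hm]
  choose e he using hex
  -- the Hecke character of `ω`, its congruence modulus, and the parallel real weights
  obtain ⟨θ, hθ⟩ := ω.1.exists_heckeCharacter_glOne
  obtain ⟨a, ha, hkill⟩ := heckeCharacter_exists_modulus_map_infiniteIdeles_unit_eq_one θ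
  obtain ⟨σ, -, hpar⟩ := exists_re_archParam_parallel_glOne ω.1 hω
  refine ⟨e, a, ha, he, fun u hu => ?_⟩
  set k : Kˣ := Units.map (algebraMap (𝓞 K) K : 𝓞 K →* K) u with hk
  have hθk : θ (infiniteIdeles K (globalToInfiniteUnits K k)) = 1 := hkill u hu
  have hu0 : ((u : 𝓞 K) : K) ≠ 0 := by exact_mod_cast Units.ne_zero u
  have hz : ∀ w : InfinitePlace K, w.embedding ((u : 𝓞 K) : K) ≠ 0 := fun w =>
    (map_ne_zero _).mpr hu0
  -- coordinates of `(u)_∞`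
  have hcoord : ∀ w : InfinitePlace K, Completion.extensionEmbedding w
      ((globalToInfiniteUnits K k : InfiniteAdeleRing K) w) = w.embedding ((u : 𝓞 K) : K) := by
    intro w
    rw [val_globalToInfiniteUnits, InfiniteAdeleRing.algebraMap_apply]
    exact Completion.extensionEmbedding_coe w (WithAbs.toAbs w.1 (k : K))
  -- logarithms
  set A : {w : InfinitePlace K // w.IsComplex} → ℂ :=
    fun w => Complex.log (w.1.embedding ((u : 𝓞 K) : K)) with hA
  have hexp : ∀ w, Complex.exp (A w) = w.1.embedding ((u : 𝓞 K) : K) :=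
    fun w => Complex.exp_log (hz w.1)
  -- the exponential formula: `1 = θ((u)_∞) = ∏_w exp (A_w E σ_w + Ā_w E σ̄_w)`
  have hval := heckeCharacter_infiniteIdeles_eq_exp_sum ω.1 hθ hω
    (c := fun w : {w : InfinitePlace K // w.IsReal} => (isEmptyElim w : ℂ)) (fun w => isEmptyElim w)
    (p := fun w => E w.1.embedding) (q := fun w => E (ComplexEmbedding.conjugate w.1.embedding))
    (fun w => rfl) (fun w => rfl) (globalToInfiniteUnits K k) (fun w => isEmptyElim w) A
    (fun w => isEmptyElim w) (fun w => by rw [hcoord, hexp])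
  rw [hθk, Units.val_one, Finset.univ_eq_empty, Finset.sum_empty, zero_add, Complex.exp_sum] at hval
  -- each factor: `exp (A_w E σ_w + Ā_w E σ̄_w) = |σ_w u|^{2σ} · archUnitaryValue e_w T_w (σ_w u)`
  have hfac : ∀ w : {w : InfinitePlace K // w.IsComplex},
      Complex.exp (A w * E w.1.embedding + conj (A w) * E (ComplexEmbedding.conjugate w.1.embedding)) =
        ((((w.1 ((u : 𝓞 K) : K)) ^ (2 * σ) : ℝ) : ℂ) *
          archUnitaryValue (e w.1)
            ((E w.1.embedding + E (ComplexEmbedding.conjugate w.1.embedding)).im)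
            (w.1.embedding ((u : 𝓞 K) : K))) := by
    intro w
    rw [exp_linear_eq_norm_cpow_mul_archUnitaryValue _ _ (e w.1) (he w.1).symm (A w), hexp w,
      hpar w _ _ rfl rfl, norm_embedding_eq, ← Complex.ofReal_cpow (apply_nonneg _ _)]
  simp_rw [hfac] at hval
  -- the modulus factor is `1`: `∏_w |u|_w = 1` (product formula, all places complex, `|N u| = 1`)
  have hall1 : ∏ w : InfinitePlace K, w ((u : 𝓞 K) : K) = 1 := by
    have hpf := prod_eq_abs_norm ((u : 𝓞 K) : K)
    rw [NumberField.Units.norm, Rat.cast_one] at hpf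
    have hsq : ∏ w : InfinitePlace K, w ((u : 𝓞 K) : K) ^ 2 = 1 := by
      rw [← hpf]
      refine Finset.prod_congr rfl fun w _ => ?_
      rw [mult, if_neg (not_isReal_iff_isComplex.mpr (hc w))]
    rw [Finset.prod_pow] at hsq
    have hnn : 0 ≤ ∏ w : InfinitePlace K, w ((u : 𝓞 K) : K) :=
      Finset.prod_nonneg fun w _ => apply_nonneg _ _
    nlinarith [hsq, hnn]
  have hmod : ∏ w : {w : InfinitePlace K // w.IsComplex},
      ((((w.1 ((u : 𝓞 K) : K)) ^ (2 * σ) : ℝ) : ℂ)) = 1 := by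
    rw [← Complex.ofReal_prod, Real.finsetProd_rpow _ _ (fun w _ => apply_nonneg _ _),
      Fintype.prod_equiv (Equiv.subtypeUnivEquiv hc) (fun w => w.1 ((u : 𝓞 K) : K))
        (fun w => w ((u : 𝓞 K) : K)) (fun w => rfl), hall1, Real.one_rpow, Complex.ofReal_one]
  rw [Finset.prod_mul_distrib, hmod, one_mul,
    Fintype.prod_equiv (Equiv.subtypeUnivEquiv hc)
      (fun w : {w : InfinitePlace K // w.IsComplex} => archUnitaryValue (e w.1)
        ((E w.1.embedding + E (ComplexEmbedding.conjugate w.1.embedding)).im)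
        (w.1.embedding ((u : 𝓞 K) : K)))
      (fun w => archUnitaryValue (e w)
        ((E w.embedding + E (ComplexEmbedding.conjugate w.embedding)).im)
        (w.embedding ((u : 𝓞 K) : K))) (fun w => rfl)] at hval
  exact hval.symm

end Summit.Langlands.Langlands.Theorems.HalfIntegralTwistCM
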